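import Summits.ABC.IUTFork.LDHGenuinePerImageContentfulAll
import Summits.ABC.IUTFork.LDHGenuinePerImageContentful
import Summits.ABC.IUTFork.LDHGenuinePerImageSzpiroGoodLowHeight
import Literature.IUT.LogVolume.GenuineLogThetaPointSevenLe
import HarnessLib

/-!
# DD3-Sketch — DECIDABLE-DATUM (abc-iut ideation seat INV-3, gen 4, cycle 3; lens `finite`; crux of record
`Summit.ABC.ABC.Theses.IUTThetaPilot.ThetaPartII` = stmt-ABC-19678, (P)-arm `stub_cor312PerImage`)

Sketch only (no `sorry`, no new axioms, no `instance`, no notation). TAKES NO SIDE on [IUTchIII] Cor. 3.12 or on any author.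
A decided numeric instance decides OUR typed (P)-arm `Cor22.Cor312PerImageAtDatum P l` at that datum, not IUT and not abc;
numeric counter-instance ≠ refutation unless realisable; typed ≠ proved; computed ≠ proved; NO abc claim.

Contents.
* §1 `NumericDatum` — the F_tpd-level integers/reals of a point `(P, l)` that the two DISPLAYS of the (P)-arm sandwich are
  functions of; `Realises P N` — the point carries exactly these numbers.
* §2 the displays as predicates on `N`: `SufDisplay` ([⇐] of `cor312PerImageAtDatum_sandwich_dmod_one_all`),
  `NecDisplayE` ([⇒], floor E = `szpiro_of_cor312PerImageAtDatum_six_all`), `NecDisplaySharp` (floor # =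
  `szpiro_of_cor312PerImageAtDatum_linear`, PNT-free count form), `Slack` (KEY: W8's hypothesis `log q ≤ 5529600·l⁴`).
* §3 kernel links: decided-TRUE (`crux_of_sufDisplay`), the two necessity floors in `N`-currency, decided-FALSE
  (`not_crux_of_not_necDisplaySharp` / `…E`), `necDisplayE_of_slack` (the slack regime is display-vacuous), vacuity rows by name.
* §4 the smallest class `C3 l h` = (F_tpd = ℚ, d_mod = 1, one bad place of norm 3 off {2,l}, local height h): in kernel at
  `l = 7`: TRUE for `h ≤ 16`, FALSE (as typed, IF realised with a datum) for `h ≥ 10400` under floor #, for `h ≥ 1.4·10¹¹`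
  under floor E. Realisability of the members is discussed in DECIDABLE-DATUM.md (S-unit equation; not formalised here).
-/

set_option linter.dupNamespace false

noncomputable section

namespace Summit.ABC.ABC.Cruxes.ThetaPartII.DD3

open Literature.IUT.LogVolume Literature.NumberTheory.DiophantineGeometry.GenEll
open Summit.ABC.IUTFork

/-! ## §1 The numeric datum -/

/-- One bad place `v ∤ 2l` of `F_tpd`: residue characteristic `p`, residue degree `f = f(v|p)`, local height
`h = −ord_v j(λ) > 0` (`= ord_v` of the `q`-parameter). The ramification index `e(v|p)` does NOT enter the displays. -/
structure PlaceDatum where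
  p : ℕ
  f : ℕ
  h : ℕ

/-- `h·f·log p` — the contribution of the place to `[F_tpd:ℚ]·log q^{∤2l}`. -/
def PlaceDatum.qTerm (v : PlaceDatum) : ℝ := (v.h : ℝ) * (v.f : ℝ) * Real.log (v.p : ℝ)

/-- `f·log p` — the contribution of the place to `[F_tpd:ℚ]·log 𝔣^{∤2l}`. -/
def PlaceDatum.condTerm (v : PlaceDatum) : ℝ := (v.f : ℝ) * Real.log (v.p : ℝ)

/-- The F_tpd-level numeric datum of an admissible `(P, l)`: `deg = [F_tpd:ℚ]`, `logDiff = (1/deg)·log|disc F_tpd|`,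
`dmod = d_mod`, the prime `l`, and the list of bad places off `{2, l}` with their `(p, f, h)`. -/
structure NumericDatum where
  deg : ℕ
  logDiff : ℝ
  dmod : ℕ
  l : ℕ
  places : List PlaceDatum

namespace NumericDatum

/-- `log q^{∤2l}` of the datum: `(1/deg)·Σ_v h_v·f_v·log p_v`. -/
def logQ (N : NumericDatum) : ℝ := (N.deg : ℝ)⁻¹ * (N.places.map PlaceDatum.qTerm).sum

/-- `log 𝔣^{∤2l}` of the datum: `(1/deg)·Σ_v f_v·log p_v`. -/
def logCond (N : NumericDatum) : ℝ := (N.deg : ℝ)⁻¹ * (N.places.map PlaceDatum.condTerm).sum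

/-- The SUFFICIENCY display ([⇐] of `Cor22.cor312PerImageAtDatum_sandwich_dmod_one_all`, p446147 layer), as a predicate on `N`. -/
def SufDisplay (N : NumericDatum) : Prop :=
  N.logQ ≤ 6 * N.l * ((N.l : ℝ) + 1) / (((N.l : ℝ) + 4) * ((N.l : ℝ) - 3)) * (N.logDiff + (1 - 1 / (N.l : ℝ)) * N.logCond)
    + 6 * N.l * ((N.l : ℝ) + 5) / (((N.l : ℝ) + 4) * ((N.l : ℝ) - 3)) * Real.log Real.pi

/-- The NECESSITY display, floor E (`PointDict.szpiro_of_cor312PerImageAtDatum_six_all`, `E₀ = 184320·deg·l⁴`). -/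
def NecDisplayE (N : NumericDatum) : Prop :=
  (1 / 6 - 2 / ((N.l : ℝ) * ((N.l : ℝ) + 1))) * N.logQ ≤
    (1 + (4 + 8 * (N.dmod : ℝ)) / N.l) * (N.logDiff + N.logCond) + 5 * Real.log N.l + 46 + 2 * Real.log Real.pi
      + 5 / 3 * (3 + Real.log ((184320 * N.deg * N.l ^ 4 : ℕ) : ℝ)) * (((184320 * N.deg * N.l ^ 4 : ℕ) : ℝ) + 3)

/-- The NECESSITY display, floor # (`PointDict.szpiro_of_cor312PerImageAtDatum_linear`, PNT-free count form, `d* = 552960·d_mod`). -/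
def NecDisplaySharp (N : NumericDatum) : Prop :=
  (1 / 6 - 2 / ((N.l : ℝ) * ((N.l : ℝ) + 1))) * N.logQ ≤
    (2 + 20 * (N.dmod : ℝ) * Real.log (((2 ^ 12 * 3 ^ 3 * 5 * N.dmod : ℕ) : ℝ) * N.l) + 8 * (N.dmod : ℝ) / N.l)
        * (N.logDiff + N.logCond)
      + (10 * Real.log (((2 ^ 12 * 3 ^ 3 * 5 * N.dmod : ℕ) : ℝ) * N.l) + 5) * (4 + Real.log N.l) + 26 + 2 * Real.log Real.pi

/-- KEY's `Slack`: W8's hypothesis `log q^{∤2l} ≤ 5529600·l⁴` (INV-3 cycle-2 `WUC3.slack_regime`). Decidable in exact arithmetic once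
`logQ` is bracketed by rationals; here a `Prop`. -/
def Slack (N : NumericDatum) : Prop := N.logQ ≤ 5529600 * (N.l : ℝ) ^ 4

end NumericDatum

/-- `P` (with the prime `N.l`) REALISES the numeric datum `N`: it has exactly these F_tpd-level numbers. (For `P = ratPoint q` the
rat-point dictionary `Cor22.logQAvoid_ratPoint_eq_sum` / `Cor22.logCondAvoid_ratPoint_eq_sum` discharges the last two clauses from
`j(q) = N/∏ p^{e_p}`.) -/
def Realises (P : NFPoint) (N : NumericDatum) : Prop :=
  P.degree = N.deg ∧ P.logDiff = N.logDiff ∧ Cor22.dmod P = N.dmod ∧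
    Cor22.logQAvoid P {2, N.l} = N.logQ ∧ Cor22.logCondAvoid P {2, N.l} = N.logCond

/-! ## §3 Kernel links (every step BY NAME) -/

variable {P : NFPoint} {N : NumericDatum}

/-- DECIDED TRUE: a realisation of a datum passing the sufficiency display satisfies the (P)-arm at `N.l` (at EVERY genuine datum `T`).
Tree: `Cor22.cor312PerImageAtDatum_of_szpiroSix` (p446147 layer). -/
theorem crux_of_sufDisplay (hR : Realises P N) (hU : P.InU) (h5 : 5 ≤ N.l) (hd : N.dmod = 1) (hs : N.SufDisplay) :
    Cor22.Cor312PerImageAtDatum P N.l := by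
  obtain ⟨_, hD, hdm, hQ, hC⟩ := hR
  refine Cor22.cor312PerImageAtDatum_of_szpiroSix hU h5 (by rw [hdm, hd]) ?_
  rw [hQ, hC, hD]
  exact hs

/-- Floor E in `N`-currency: the crux at a realised datum carrying a genuine datum `T` forces `NecDisplayE N`.
Tree: `PointDict.szpiro_of_cor312PerImageAtDatum_six_all` (p448016). -/
theorem necDisplayE_of_crux (hR : Realises P N) (hP : P ∈ UP) (h7 : 7 ≤ N.l) (T : Cor22.ThetaVolumeDatumAt P N.l)
    (h : Cor22.Cor312PerImageAtDatum P N.l) : N.NecDisplayE := by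
  obtain ⟨hdeg, hD, hdm, hQ, hC⟩ := hR
  have hmain := PointDict.szpiro_of_cor312PerImageAtDatum_six_all hP h7 h T
  rw [hQ, hC, hD, hdm, hdeg] at hmain
  exact hmain

/-- Floor # in `N`-currency: the crux at a realised datum carrying a genuine datum `T` forces `NecDisplaySharp N`.
Tree: `PointDict.szpiro_of_cor312PerImageAtDatum_linear` (PNT-free count form). -/
theorem necDisplaySharp_of_crux (hR : Realises P N) (hP : P ∈ UP) (h7 : 7 ≤ N.l) (T : Cor22.ThetaVolumeDatumAt P N.l)
    (h : Cor22.Cor312PerImageAtDatum P N.l) : N.NecDisplaySharp := by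
  obtain ⟨hdeg, hD, hdm, hQ, hC⟩ := hR
  have hmain := PointDict.szpiro_of_cor312PerImageAtDatum_linear hP h7 h T
  rw [hQ, hC, hD, hdm] at hmain
  exact hmain

/-- DECIDED FALSE (as typed, AT a realisation carrying a datum): failure of floor # kills the (P)-arm at `(P, N.l)`. A numeric `N` with
`¬ NecDisplaySharp N` is a COUNTER-INSTANCE only if some admissible `P` realises it with `ThetaDataExistsAt P N.l`. -/
theorem not_crux_of_not_necDisplaySharp (hR : Realises P N) (hP : P ∈ UP) (h7 : 7 ≤ N.l) (hT : Cor22.ThetaDataExistsAt P N.l)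
    (hn : ¬ N.NecDisplaySharp) : ¬ Cor22.Cor312PerImageAtDatum P N.l :=
  fun h => hn (necDisplaySharp_of_crux hR hP h7 (Classical.choice hT) h)

/-- The same with floor E. -/
theorem not_crux_of_not_necDisplayE (hR : Realises P N) (hP : P ∈ UP) (h7 : 7 ≤ N.l) (hT : Cor22.ThetaDataExistsAt P N.l)
    (hn : ¬ N.NecDisplayE) : ¬ Cor22.Cor312PerImageAtDatum P N.l :=
  fun h => hn (necDisplayE_of_crux hR hP h7 (Classical.choice hT) h)

/-- Without a datum the (P)-arm is vacuously TRUE (tree: `Cor22.cor312PerImageAtDatum_of_not_exists`); in particular at `l = 5`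
for EVERY point (`Cor22.not_thetaDataExistsAt_five`) and at every `l < 7`. -/
theorem crux_five (P : NFPoint) : Cor22.Cor312PerImageAtDatum P 5 :=
  Cor22.cor312PerImageAtDatum_of_not_exists (Cor22.not_thetaDataExistsAt_five P)

theorem crux_of_lt_seven (P : NFPoint) {l : ℕ} (hl : l < 7) : Cor22.Cor312PerImageAtDatum P l :=
  Cor22.cor312PerImageAtDatum_of_not_exists (Cor22.not_thetaDataExistsAt_of_lt_seven hl)

/-- THE SLACK REGIME IS DISPLAY-VACUOUS (floor E): pure arithmetic, port of INV-3 cycle-2 `WUC3.slack_regime` to `N`-currency.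
Hypotheses: the sign conditions every realised datum satisfies (`logQ, logDiff + logCond ≥ 0`, `deg ≥ 1`) and `l ≥ 7`. -/
theorem necDisplayE_of_slack (h7 : 7 ≤ N.l) (hdeg : 1 ≤ N.deg) (hQ0 : 0 ≤ N.logQ) (hL0 : 0 ≤ N.logDiff + N.logCond)
    (hs : N.Slack) : N.NecDisplayE := by
  unfold NumericDatum.NecDisplayE
  unfold NumericDatum.Slack at hs
  set Q : ℝ := N.logQ with hQdef
  set L : ℝ := N.logDiff + N.logCond with hLdef
  set E : ℝ := ((184320 * N.deg * N.l ^ 4 : ℕ) : ℝ) with hEdef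
  have hl : (7 : ℝ) ≤ N.l := by exact_mod_cast h7
  have hd0 : (0 : ℝ) ≤ (N.dmod : ℝ) := by positivity
  have hEn : 184320 * 1 * N.l ^ 4 ≤ 184320 * N.deg * N.l ^ 4 :=
    Nat.mul_le_mul_right _ (Nat.mul_le_mul_left _ hdeg)
  have hE : 184320 * (N.l : ℝ) ^ 4 ≤ E := by
    have := (Nat.cast_le (α := ℝ)).mpr hEn
    rw [hEdef]
    push_cast at this ⊢
    linarith
  have hl4 : (1 : ℝ) ≤ (N.l : ℝ) ^ 4 := one_le_pow₀ (by linarith)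
  have hE1 : 1 ≤ E := by linarith
  have hlogE : 0 ≤ Real.log E := Real.log_nonneg hE1
  have hlogl : 0 ≤ Real.log N.l := Real.log_nonneg (by linarith)
  have hpi : 0 ≤ Real.log Real.pi := Real.log_nonneg (by linarith [Real.pi_gt_three])
  have hfrac : 0 ≤ 2 / ((N.l : ℝ) * ((N.l : ℝ) + 1)) := by positivity
  have h1 : (1 / 6 - 2 / ((N.l : ℝ) * ((N.l : ℝ) + 1))) * Q ≤ Q / 6 := by nlinarith
  have hcoef : 0 ≤ 1 + (4 + 8 * (N.dmod : ℝ)) / N.l := by positivity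
  have h2 : 0 ≤ (1 + (4 + 8 * (N.dmod : ℝ)) / N.l) * L := mul_nonneg hcoef hL0
  have h3 : 5 * E ≤ 5 / 3 * (3 + Real.log E) * (E + 3) := by nlinarith
  linarith

/-- Every realised datum satisfies the sign conditions of `necDisplayE_of_slack`. -/
theorem signs_of_realises (hR : Realises P N) : 1 ≤ N.deg ∧ 0 ≤ N.logQ ∧ 0 ≤ N.logDiff + N.logCond := by
  obtain ⟨hdeg, hD, _, hQ, hC⟩ := hR
  refine ⟨?_, ?_, ?_⟩
  · rw [← hdeg]; exact Module.finrank_pos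
  · rw [← hQ]; exact Cor22.logQAvoid_nonneg P _
  · rw [← hD, ← hC]; exact add_nonneg P.logDiff_nonneg (Cor22.logCondAvoid_nonneg P _)

/-! ## §4 The smallest class: `F_tpd = ℚ`, one bad place of norm 3 off `{2, l}`, local height `h` -/

/-- `C3 l h`: `deg = 1`, `logDiff = 0`, `d_mod = 1`, prime `l`, places `[(3, 1, h)]`. -/
def C3 (l h : ℕ) : NumericDatum := ⟨1, 0, 1, l, [⟨3, 1, h⟩]⟩

theorem C3_logQ (l h : ℕ) : (C3 l h).logQ = (h : ℝ) * Real.log 3 := by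
  simp [C3, NumericDatum.logQ, PlaceDatum.qTerm]

theorem C3_logCond (l h : ℕ) : (C3 l h).logCond = Real.log 3 := by
  simp [C3, NumericDatum.logCond, PlaceDatum.condTerm]

/-! ### crude certified log brackets (only Mathlib's `exp 1`, `log 2`, `π` constants; atoms are `set` before `linarith`) -/

theorem one_le_log_three : 1 ≤ Real.log 3 := by
  have h : Real.exp 1 ≤ 3 := by have := Real.exp_one_lt_d9; linarith
  have := Real.log_le_log (Real.exp_pos 1) h
  rwa [Real.log_exp] at this

theorem log_three_le : Real.log 3 ≤ 1.2 := by
  have h32 : Real.log (3 / 2) ≤ 3 / 2 - 1 := Real.log_le_sub_one_of_pos (by norm_num)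
  have hmul : Real.log 3 = Real.log 2 + Real.log (3 / 2) := by
    rw [← Real.log_mul (by norm_num) (by norm_num)]; norm_num
  have h2 := Real.log_two_lt_d9
  set A := Real.log 3
  set B := Real.log 2
  set C := Real.log (3 / 2 : ℝ)
  linarith

theorem one_le_log_pi : 1 ≤ Real.log Real.pi := by
  have h : Real.exp 1 ≤ Real.pi := by have := Real.exp_one_lt_d9; linarith [Real.pi_gt_three]
  have := Real.log_le_log (Real.exp_pos 1) h
  rwa [Real.log_exp] at this

theorem log_pi_le : Real.log Real.pi ≤ 1.4 := by
  have h : Real.log Real.pi ≤ Real.log 4 := Real.log_le_log Real.pi_pos Real.pi_le_four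
  have h4 : Real.log 4 = 2 * Real.log 2 := by
    rw [show (4 : ℝ) = 2 ^ 2 by norm_num, Real.log_pow]; push_cast; ring
  have h2 := Real.log_two_lt_d9
  set A := Real.log Real.pi
  set B := Real.log 2
  set C := Real.log (4 : ℝ)
  linarith

theorem log_seven_le : Real.log 7 ≤ 2.1 := by
  have h : Real.log 7 ≤ Real.log 8 := Real.log_le_log (by norm_num) (by norm_num)
  have h8 : Real.log 8 = 3 * Real.log 2 := by
    rw [show (8 : ℝ) = 2 ^ 3 by norm_num, Real.log_pow]; push_cast; ring
  have h2 := Real.log_two_lt_d9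
  set A := Real.log (7 : ℝ)
  set B := Real.log 2
  set C := Real.log (8 : ℝ)
  linarith

theorem one_le_log_seven : 1 ≤ Real.log 7 :=
  one_le_log_three.trans (Real.log_le_log (by norm_num) (by norm_num))

/-- `log(552960·7) = log 3870720 ≤ 22·log 2 ≤ 15.26` (`3870720 ≤ 2^22`). -/
theorem log_dstar_seven_le : Real.log (3870720 : ℝ) ≤ 15.26 := by
  have h : Real.log (3870720 : ℝ) ≤ Real.log ((2 : ℝ) ^ 22) := Real.log_le_log (by norm_num) (by norm_num)
  have h22 : Real.log ((2 : ℝ) ^ 22) = 22 * Real.log 2 := by rw [Real.log_pow]; push_cast; ring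
  have h2 := Real.log_two_lt_d9
  rw [h22] at h
  set A := Real.log (3870720 : ℝ)
  set B := Real.log 2
  linarith

/-- `log E₀ = log 442552320 ≤ 29·log 2 ≤ 20.11` (`E₀ = 184320·7⁴ ≤ 2^29`). -/
theorem log_E0_seven_le : Real.log (442552320 : ℝ) ≤ 20.11 := by
  have h : Real.log (442552320 : ℝ) ≤ Real.log ((2 : ℝ) ^ 29) := Real.log_le_log (by norm_num) (by norm_num)
  have h29 : Real.log ((2 : ℝ) ^ 29) = 29 * Real.log 2 := by rw [Real.log_pow]; push_cast; ring
  have h2 := Real.log_two_lt_d9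
  rw [h29] at h
  set A := Real.log (442552320 : ℝ)
  set B := Real.log 2
  linarith

/-! ### the class `C3 7 h` decided in kernel -/

theorem C3_l (l h : ℕ) : (C3 l h).l = l := rfl
theorem C3_deg (l h : ℕ) : (C3 l h).deg = 1 := rfl
theorem C3_dmod (l h : ℕ) : (C3 l h).dmod = 1 := rfl
theorem C3_logDiff (l h : ℕ) : (C3 l h).logDiff = 0 := rfl

/-- TRUE side: `h ≤ 16` ⟹ the sufficiency display holds at `l = 7` (sharp numeric threshold: `h ≤ 18`). -/
theorem sufDisplay_C3_seven {h : ℕ} (hh : h ≤ 16) : (C3 7 h).SufDisplay := by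
  unfold NumericDatum.SufDisplay
  rw [C3_logQ, C3_logCond, C3_l, C3_logDiff]
  push_cast
  have hhR : (h : ℝ) ≤ 16 := by exact_mod_cast hh
  have h3 := one_le_log_three
  have h3' := log_three_le
  have hπ := one_le_log_pi
  have q1 : (h : ℝ) * Real.log 3 ≤ 16 * Real.log 3 := mul_le_mul_of_nonneg_right hhR (by linarith)
  set H : ℝ := (h : ℝ)
  set L3 := Real.log 3
  set LP := Real.log Real.pi
  set X := H * L3
  norm_num
  linarith

/-- Hence: EVERY realisation of `C3 7 h`, `h ≤ 16`, in `U` satisfies the (P)-arm at `l = 7` (whether or not a datum exists); in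
particular the two REALISABLE heights `h = 2, 4` of the class over `F_tpd = ℚ` (DECIDABLE-DATUM.md §3) are decided TRUE. -/
theorem crux_C3_seven_of_le {h : ℕ} (hh : h ≤ 16) (hR : Realises P (C3 7 h)) (hU : P.InU) :
    Cor22.Cor312PerImageAtDatum P 7 :=
  crux_of_sufDisplay (N := C3 7 h) hR hU (by norm_num [C3]) rfl (sufDisplay_C3_seven hh)

/-- FALSE side, floor #: `h ≥ 10500` ⟹ the sharp necessity display FAILS at `l = 7` (sharp numeric threshold: `h ≥ 9029`). -/
theorem not_necDisplaySharp_C3_seven {h : ℕ} (hh : 10500 ≤ h) : ¬ (C3 7 h).NecDisplaySharp := by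
  unfold NumericDatum.NecDisplaySharp
  have e2 : (((2 ^ 12 * 3 ^ 3 * 5 * (C3 7 h).dmod : ℕ) : ℝ) * ((C3 7 h).l : ℝ)) = 3870720 := by norm_num [C3]
  rw [C3_logQ, C3_logCond, e2, C3_l, C3_logDiff, C3_dmod]
  push_cast
  have hhR : (10500 : ℝ) ≤ h := by exact_mod_cast hh
  have h3 := one_le_log_three
  have h3' := log_three_le
  have hπ := log_pi_le
  have h7 := log_seven_le
  have h7' := one_le_log_seven
  have hΛ := log_dstar_seven_le
  have hΛ0 : 0 ≤ Real.log (3870720 : ℝ) := Real.log_nonneg (by norm_num)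
  have q1 : (10500 : ℝ) * 1 ≤ (h : ℝ) * Real.log 3 := mul_le_mul hhR h3 (by norm_num) (by positivity)
  have q2 : Real.log (3870720 : ℝ) * Real.log 3 ≤ 15.26 * 1.2 := mul_le_mul hΛ h3' (by linarith) (by norm_num)
  have q3 : Real.log (3870720 : ℝ) * Real.log 7 ≤ 15.26 * 2.1 := mul_le_mul hΛ h7 (by linarith) (by norm_num)
  set H : ℝ := (h : ℝ)
  set L3 := Real.log 3
  set L7 := Real.log 7
  set LP := Real.log Real.pi
  set Λ := Real.log (3870720 : ℝ)
  set X := H * L3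
  set Y := Λ * L3
  set Z := Λ * L7
  intro hc
  have hc' : (1 / 6 - 2 / (7 * (7 + 1))) * X ≤ (2 + 20 * Λ + 8 / 7) * L3 + (10 * Λ + 5) * (4 + L7) + 26 + 2 * LP := by
    convert hc using 2; ring
  nlinarith

/-- FALSE side, floor E (KEY's slack currency): `h ≥ 1.4·10¹¹` ⟹ `NecDisplayE` FAILS at `l = 7` (sharp: `h ≥ 1.18·10¹¹`); such data
are NON-SLACK (the slack ones all satisfy `NecDisplayE`: `necDisplayE_of_slack`). -/
theorem not_necDisplayE_C3_seven {h : ℕ} (hh : 140000000000 ≤ h) : ¬ (C3 7 h).NecDisplayE := by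
  unfold NumericDatum.NecDisplayE
  have e1 : (((184320 * (C3 7 h).deg * (C3 7 h).l ^ 4 : ℕ) : ℝ)) = 442552320 := by norm_num [C3]
  rw [C3_logQ, C3_logCond, e1, C3_l, C3_logDiff, C3_dmod]
  push_cast
  have hhR : (140000000000 : ℝ) ≤ h := by exact_mod_cast hh
  have h3 := one_le_log_three
  have h3' := log_three_le
  have hπ := log_pi_le
  have h7 := log_seven_le
  have hE := log_E0_seven_le
  have hE0 : 0 ≤ Real.log (442552320 : ℝ) := Real.log_nonneg (by norm_num)
  have q1 : (140000000000 : ℝ) * 1 ≤ (h : ℝ) * Real.log 3 := mul_le_mul hhR h3 (by norm_num) (by positivity)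
  set H : ℝ := (h : ℝ)
  set L3 := Real.log 3
  set L7 := Real.log 7
  set LP := Real.log Real.pi
  set LE := Real.log (442552320 : ℝ)
  set X := H * L3
  intro hc
  have hc' : (1 / 6 - 2 / (7 * (7 + 1))) * X ≤
      (1 + (4 + 8) / 7) * L3 + 5 * L7 + 46 + 2 * LP + 5 / 3 * (3 + LE) * (442552320 + 3) := by
    convert hc using 2; ring
  nlinarith

/-- … whereas every `C3 7 h` with `h ≤ 1.1·10¹⁰` is SLACK (hence `NecDisplayE` holds there with no input: `necDisplayE_of_slack`). -/
theorem slack_C3_seven {h : ℕ} (hh : h ≤ 11000000000) : (C3 7 h).Slack := by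
  unfold NumericDatum.Slack
  rw [C3_logQ, C3_l]
  push_cast
  have hhR : (h : ℝ) ≤ 11000000000 := by exact_mod_cast hh
  have h3' := log_three_le
  have h3 := one_le_log_three
  have q1 : (h : ℝ) * Real.log 3 ≤ 11000000000 * Real.log 3 := mul_le_mul_of_nonneg_right hhR (by linarith)
  set H : ℝ := (h : ℝ)
  set L3 := Real.log 3
  set X := H * L3
  norm_num
  linarith

/-- CONSEQUENCE (decided FALSE as typed, conditionally on realisation): IF an admissible `P ∈ UP` realises `C3 7 h` with
`h ≥ 10500` AND carries a genuine datum at `l = 7`, the (P)-arm fails at `(P, 7)`. DECIDABLE-DATUM.md §3: over `F_tpd = ℚ` NO such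
`P` exists (the `{2,3}`-unit equation leaves `h ∈ {2, 4}` only) — a numeric counter-instance, not a refutation. -/
theorem not_crux_C3_seven_of_realises {h : ℕ} (hh : 10500 ≤ h) (hR : Realises P (C3 7 h)) (hP : P ∈ UP)
    (hT : Cor22.ThetaDataExistsAt P 7) : ¬ Cor22.Cor312PerImageAtDatum P 7 :=
  not_crux_of_not_necDisplaySharp (N := C3 7 h) hR hP (by norm_num [C3]) hT (not_necDisplaySharp_C3_seven hh)

end Summit.ABC.ABC.Cruxes.ThetaPartII.DD3

end
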